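import Summits.CriticalPhenomena.PercolationContinuityZ3.Theorems.PercNearOneGluingNoHeavyLowerTailKNGoodTwinStarsGC
import HarnessLib

/-!
# Kozma–Nitzan goodness for an observer with TWIN pendant two-port star children (same two ports), over an ARBITRARY core
# (`NoHeavyLowerTail` cell, stmt-CriticalPhenomena-4575; prover `prim-hp-2`, deletion–contraction line, gen 8)

Support file (`--supports stmt-CriticalPhenomena-4575`).  No definitions, no named facts, no sorries.

THEOREM `KNGoodTwoTwo.knGood_twinTwoPortStars`: `o ∉ A` with relay hairs (free) and two Steiner children `x, y ∉ A`, both pendant stars with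
the SAME two ports `p₁ ≠ p₂ ∈ A` (the hairs of `y` in `(0,1)`, those of `x` arbitrary), everything else ARBITRARY ⟹ `(G, A, o, b)` is good.
This closes the list of two-children configurations with at most two ports per child over an arbitrary core: single-port child
(`KNGoodSinglePort`), disjoint ports (`knGood_twoPendantTwoPortStars`), one shared port (`knGood_twoPendantTwoPortStars_shared`), both ports
shared (this file).  Assembly as in the shared case with `KNGoodTwoTwo.gc_twinStars`.
-/

namespace Summit.CriticalPhenomena.PercolationContinuityZ3.Theorems

open MeasureTheory Set ProbabilityTheory Literature.Probability.LatticeModels Literature.Probability.Percolation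

noncomputable section
open Classical
namespace KNGoodTwoTwo
open UpsetExchange KNGoodAux KNGoodSeries KNGoodHair KNGoodSeriesEasy RelayNbhd

variable {n : ℕ}

/-- **Goodness for `o` + relay hairs + twin pendant two-port stars, over an arbitrary core.**  See the module docstring.
[cite: KozmaNitzan2024, §3.2 Definition (p. 12), Thm. 4–5 and Lemma 5 (pp. 12–14), Lemma 3(i) (p. 6); VandenbergHaggstromKahn2005, Thm. 1.2] -/
theorem knGood_twinTwoPortStars (w : Sym2 (Fin n) → unitInterval) (A : Finset (Fin n)) (hA : A.Nonempty)
    (o x y b p₁ p₂ : Fin n) (ho : o ∉ A) (hx : x ∉ A) (hy : y ∉ A) (hxo : x ≠ o) (hyo : y ≠ o) (hxy : x ≠ y)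
    (hbo : b ≠ o) (hbx : b ≠ x) (hby : b ≠ y)
    (hp₁ : p₁ ∈ A) (hp₂ : p₂ ∈ A) (hp : p₁ ≠ p₂)
    (hoN : ∀ v : Fin n, v ≠ o → v ∉ A → v ≠ x → v ≠ y → w s(o, v) = 0)
    (hxN : ∀ z : Fin n, z ≠ p₁ → z ≠ p₂ → z ≠ o → w s(x, z) = 0)
    (hyN : ∀ z : Fin n, z ≠ p₁ → z ≠ p₂ → z ≠ o → w s(y, z) = 0)
    (hk₁ : 0 < (w s(y, p₁) : ℝ)) (hk₁' : (w s(y, p₁) : ℝ) < 1) (hk₂ : 0 < (w s(y, p₂) : ℝ)) (hk₂' : (w s(y, p₂) : ℝ) < 1) :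
    KNGood w A hA o b := by
  haveI : ∀ v : Sym2 (Fin n) → unitInterval, IsProbabilityMeasure (prodBernoulli v) := fun v => inferInstance
  have hxp₁ : x ≠ p₁ := fun h => hx (h ▸ hp₁); have hxp₂ : x ≠ p₂ := fun h => hx (h ▸ hp₂)
  have hyp₁ : y ≠ p₁ := fun h => hy (h ▸ hp₁); have hyp₂ : y ≠ p₂ := fun h => hy (h ▸ hp₂)
  have hp₁o : p₁ ≠ o := fun h => ho (h ▸ hp₁); have hp₂o : p₂ ≠ o := fun h => ho (h ▸ hp₂)
  -- delete the relay hairs at `o`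
  set w' : Sym2 (Fin n) → unitInterval := fun e => if ∃ q' ∈ A, e = s(o, q') then 0 else w e with hw'
  refine knGood_of_deleteHairs w A hA o b ho ?_
  rw [← hw']
  have hpin : pinW w' {e : Sym2 (Fin n) | o ∈ e ∧ ¬ e.IsDiag} ∅ = pinW w {e : Sym2 (Fin n) | o ∈ e ∧ ¬ e.IsDiag} ∅ := by
    refine pinW_star_eq_of_eqOff w w' o fun e he => ?_
    rw [hw']; simp only; rw [if_neg]; rintro ⟨q', hq', rfl⟩
    exact he ⟨Sym2.mem_mk_left o q', fun hd => ho ((Sym2.mk_isDiag_iff.1 hd) ▸ hq')⟩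
  set u := pinW w {e : Sym2 (Fin n) | o ∈ e ∧ ¬ e.IsDiag} ∅ with hu
  have huoff : ∀ c d : Fin n, c ≠ o → d ≠ o → u s(c, d) = w s(c, d) := by
    intro c d hc hd
    have hmem : s(c, d) ∉ {e : Sym2 (Fin n) | o ∈ e ∧ ¬ e.IsDiag} := by
      rintro ⟨hoe, -⟩; rcases Sym2.mem_iff.1 hoe with h | h; exacts [hc h.symm, hd h.symm]
    rw [hu, pinW_apply_of_not_mem w ∅ hmem]
  have huo : ∀ v : Fin n, v ≠ o → u s(v, o) = 0 := by
    intro v hv; rw [Sym2.eq_swap, hu]; exact pinW_star_mk w hv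
  have hxNu : ∀ z : Fin n, z ≠ p₁ → z ≠ p₂ → u s(x, z) = 0 := by
    intro z hz1 hz2
    by_cases hzo : z = o
    · rw [hzo]; exact huo x hxo
    · rw [huoff x z hxo hzo]; exact hxN z hz1 hz2 hzo
  have hyNu : ∀ z : Fin n, z ≠ p₁ → z ≠ p₂ → u s(y, z) = 0 := by
    intro z hz1 hz2
    by_cases hzo : z = o
    · rw [hzo]; exact huo y hyo
    · rw [huoff y z hyo hzo]; exact hyN z hz1 hz2 hzo
  have huy1 : u s(y, p₁) = w s(y, p₁) := huoff y p₁ hyo hp₁o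
  have huy2 : u s(y, p₂) = w s(y, p₂) := huoff y p₂ hyo hp₂o
  -- goodness of the two children in `G − o` (Kozma–Nitzan, Thm. 4)
  have hgoodx : KNGood u A hA x b :=
    KozmaNitzan2024_thm4_good u A hA x b hx fun z _ hzA => hxNu z (fun h => hzA (h ▸ hp₁)) (fun h => hzA (h ▸ hp₂))
  have hgoody : KNGood u A hA y b :=
    KozmaNitzan2024_thm4_good u A hA y b hy fun z _ hzA => hyNu z (fun h => hzA (h ▸ hp₁)) (fun h => hzA (h ▸ hp₂))
  -- the witness and the gluing inequality
  obtain ⟨a₀, ha₀, hmin⟩ := A.exists_min_image (fun a => (prodBernoulli u).real (openConn a b)) hA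
  have hGC := gc_twinStars u A hA x y p₁ p₂ b hxy hxp₁ hxp₂ hyp₁ hyp₂ hp hbx hby hyNu hx hy hp₁ hp₂
    a₀ ha₀ hxNu (by rw [huy1]; exact hk₁) (by rw [huy1]; exact hk₁') (by rw [huy2]; exact hk₂) (by rw [huy2]; exact hk₂') hmin
  -- the series step
  exact knGood_series_of_gluing w' A hA o x y a₀ b ho hxo hyo hxy ha₀ hbo
    (fun v hvo hvx hvy => by
      rw [hw']; simp only
      by_cases hvA : v ∈ A
      · rw [if_pos ⟨v, hvA, rfl⟩]; rfl
      · rw [if_neg]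
        · exact congrArg Subtype.val (hoN v hvo hvA hvx hvy)
        · rintro ⟨q', hq', hvq⟩
          exact hvA ((Sym2.congr_right.1 hvq) ▸ hq'))
    (by rw [hpin]; exact hmin) (by rw [hpin]; exact hgoodx) (by rw [hpin]; exact hgoody) (by rw [hpin]; linarith [hGC])

end KNGoodTwoTwo

end

end Summit.CriticalPhenomena.PercolationContinuityZ3.Theorems
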